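import Summits.BirchSwinnertonDyer.BirchSwinnertonDyer.Theorems.CMKolyvaginAtInertTwoGenusDefectConsequencesAtTwo
import Summits.BirchSwinnertonDyer.BirchSwinnertonDyer.Theses.CMKolyvaginAtInertTwo
import HarnessLib

/-!
# Route `CMKolyvaginAtInertTwo`, item R0 `CMHeegnerTwoPrimitiveOfTrivialShaTwo` (stmt-BirchSwinnertonDyer-28176) —
# THE «Σ ≤ 1» RESTRICTION OF R0 IS LOSSLESS (modulo the route's four prints)

Seat `bsd-line-cmk2-p1` g23 (cell `bsd-print-cf2`), `--supports stmt-BirchSwinnertonDyer-28176` (helper; closes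
nothing).  THEOREMS ONLY (no definition, no named fact, no `sorry`).  BSD is NOT proved by this.

The pen's pending «KC Σ-restriction» (HOME `cmk-rev20/KC-SIGMA-RESTRICT-g23.md`, turnkey
`Cruxes/CMExactDescentAtTwo/TURNKEY_route_edit_24648_onebit.lean`) restricts R0/R1/KC to Heegner fields of
one-bit genus defect `Σ_E(d_K) ≤ 1`.  For R0 (the trivial-Ш regime) nothing is lost: by g20's
`KolyvaginGenusTwo.two_pow_sum_defect_le_card_sha_two_baseChange_mul_two` (the count identity of g15, modulo
Gross–Zagier at every level, GZK, modularity, Milne any-model) every H₂ frame with `y_K` of infinite order has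
`2^{Σ} ≤ #Ш(E_K)(2) · 2`; so `Ш(E_K)(2) = ⊥` forces `Σ ≤ 1`, i.e. R0's hypothesis is only ever met on one-bit
fields.  Hence

* `sum_defect_le_one_of_sha_two_eq_bot_of_printedInputs` — on H₂, `Ш(E_K)(2) = ⊥ ⇒ Σ_E(d_K) ≤ 1` (mod prints);
* `cmHeegnerTwoPrimitiveOfTrivialShaTwo_of_oneBit_of_printedInputs` — **(four prints) ∧ R0¹ ⟹ R0**, where R0¹ is
  the route decl `CMHeegnerTwoPrimitiveOfTrivialShaTwo` with «Σ ≤ 1 →» inserted after the Heegner hypothesis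
  (text = the turnkey's `CMHeegnerTwoPrimitiveOfTrivialShaTwoOneBit`, spelled out as a hypothesis here because it
  is not a route decl yet); the converse restriction R0 ⟹ R0¹ is trivial.

References: [Milne1972ArithmeticAV] Thm. 1; [Kramer1981] Prop. 3; [GrossZagier1986] I (6.3); [GrossLMS1991] §2.
-/

set_option autoImplicit false
-- the Theorems namespace of this sub repeats the summit name by design (D-0017 nested layout)
set_option linter.dupNamespace false

noncomputable section

open scoped Classical

namespace Summit.BirchSwinnertonDyer.BirchSwinnertonDyer.Theorems.KolyvaginGenusTwo

open WeierstrassCurve NumberField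
open Literature.NumberTheory.EllipticCurves Literature.NumberTheory.EllipticCurves.ModularForms
open Literature.NumberTheory.EllipticCurves.RingClassField
open Summit.BirchSwinnertonDyer.BirchSwinnertonDyer.Theses.CMKolyvaginAtInertTwo (CMHeegnerTwoPrimitiveOfTrivialShaTwo)

/-- **On H₂, a trivial `Ш(E_K)(2)` forces one-bit genus defect** (modulo the four prints): for `W` globally
minimal with CM, `2` inert in the CM field, `ρ̄_{E,2}` onto, `K` imaginary quadratic with odd `d_K` and the
Heegner hypothesis, and a frame with `y_K = P(1)` of infinite order, if `Ш(E_K)[2^∞] = ⊥` then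
`Σ_{q ∣ d_K} ([(Δ/q) = −1] + 2·[(Δ/q) = 1 ∧ a_q even]) ≤ 1`.  From `2^{Σ} ≤ #Ш(E_K)(2)·2`.
[cite: Milne1972ArithmeticAV, Thm. 1] [cite: Kramer1981, Prop. 3] [cite: GrossZagier1986, I (6.3)] -/
theorem sum_defect_le_one_of_sha_two_eq_bot_of_printedInputs
    (hGZ : ∀ (N : ℕ) [NeZero N] (W : WeierstrassCurve ℚ) (K : Type) [Field K] [NumberField K], gross_zagier N W K)
    (hGZK : rank_eq_analyticRank_of_analyticRank_le_one) (hmod : hasEntireLFunction_rat)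
    (hMilneC : Milne1972.bsdQuotient_baseChange_quadratic_anyModel)
    (W : WeierstrassCurve ℚ) [W.IsElliptic] [W.IsGloballyMinimal] [NeZero (W.conductorNorm ℤ)]
    (hCM : W.HasCM) (hin : Literature.NumberTheory.EllipticCurves.Rank1Residual.CMInert W 2)
    (hρ : W.HasSurjectiveModNGaloisRep 2) {K : Type} [Field K] [NumberField K] (hK : IsImaginaryQuadratic K)
    (hoddK : Odd (NumberField.discr K)) (hH : SatisfiesHeegnerHypothesis (W.conductorNorm ℤ) K)
    (Dt : ModularParametrizationData W (W.conductorNorm ℤ)) (β : ℤ) (ιK : K →+* ℂ) (d₁ : KolyvaginHeegnerData Dt β ιK 1)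
    (hy : ¬ IsOfFinAddOrder d₁.derivedPoint)
    (hsha : AddCommGroup.primaryComponent (W.baseChange K).sha 2 = ⊥) :
    ∑ q ∈ (NumberField.discr K).natAbs.primeFactors,
        ((if jacobiSym W.Δ.num q = -1 then 1 else 0) +
          (if jacobiSym W.Δ.num q = 1 ∧ Even (W.frobeniusTrace q) then 2 else 0)) ≤ 1 := by
  have hle := two_pow_sum_defect_le_card_sha_two_baseChange_mul_two W hGZ hGZK hmod hMilneC hCM hin hρ hK hoddK hH
    Dt β ιK d₁ hy
  rw [hsha, AddSubgroup.card_bot, one_mul] at hle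
  have h2 : (2 : ℕ) = 2 ^ 1 := (pow_one 2).symm
  rw [h2] at hle
  exact (Nat.pow_le_pow_iff_right (by norm_num)).mp hle

/-- **(four prints) ∧ R0¹ ⟹ R0: the «Σ ≤ 1» restriction of `CMHeegnerTwoPrimitiveOfTrivialShaTwo` loses
nothing.**  The hypothesis `hR0₁` is the route decl R0 (stmt-28176) VERBATIM with the one-bit clause «Σ ≤ 1 →»
inserted right after the Heegner hypothesis (the pen's proposed `CMHeegnerTwoPrimitiveOfTrivialShaTwoOneBit`);
the conclusion is R0 itself.  Proof: on a frame with `Ш(E_K)(2) = ⊥` the previous theorem supplies `Σ ≤ 1`,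
so R0¹ applies.  Conditional on Gross–Zagier (all levels), GZK, modularity and Milne any-model (route items
24148, 19921, 19273, 24149); closes nothing by itself.
[cite: GrossLMS1991, §2 (2.2)–(2.4)] [cite: Milne1972ArithmeticAV, Thm. 1] [cite: Kramer1981, Prop. 3] -/
theorem cmHeegnerTwoPrimitiveOfTrivialShaTwo_of_oneBit_of_printedInputs
    (hGZ : ∀ (N : ℕ) [NeZero N] (W : WeierstrassCurve ℚ) (K : Type) [Field K] [NumberField K], gross_zagier N W K)
    (hGZK : rank_eq_analyticRank_of_analyticRank_le_one) (hmod : hasEntireLFunction_rat)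
    (hMilneC : Milne1972.bsdQuotient_baseChange_quadratic_anyModel)
    (hR0₁ : ∀ (W : WeierstrassCurve ℚ) [W.IsElliptic] [W.IsGloballyMinimal] [NeZero (W.conductorNorm ℤ)], W.HasCM →
      Literature.NumberTheory.EllipticCurves.Rank1Residual.CMInert W 2 → W.HasSurjectiveModNGaloisRep (2 : ℤ) →
      W.analyticRank = 1 → Odd W.tamagawaProduct → ∀ (K : Type) [Field K] [NumberField K],
      Literature.NumberTheory.EllipticCurves.IsImaginaryQuadratic K → Odd (NumberField.discr K) → NumberField.discr K ≠ -3 →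
      Literature.NumberTheory.EllipticCurves.SatisfiesHeegnerHypothesis (W.conductorNorm ℤ) K →
      (∑ q ∈ (NumberField.discr K).natAbs.primeFactors, ((if jacobiSym W.Δ.num q = -1 then 1 else 0) +
        (if jacobiSym W.Δ.num q = 1 ∧ Even (W.frobeniusTrace q) then 2 else 0)) ≤ 1) →
      ∀ (Dt : Literature.NumberTheory.EllipticCurves.ModularForms.ModularParametrizationData W (W.conductorNorm ℤ)),
      (∀ z ∈ Dt.L.lattice, ∃ w ∈ Literature.NumberTheory.EllipticCurves.ModularForms.periodLattice Dt.f, z = (Dt.c : ℂ) * w) →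
      Odd Dt.c → ∀ (β : ℤ) (ι : K →+* ℂ) (d₁ : Literature.NumberTheory.EllipticCurves.KolyvaginHeegnerData Dt β ι 1),
      ¬ IsOfFinAddOrder d₁.derivedPoint → AddCommGroup.primaryComponent (W.baseChange K).sha 2 = ⊥ →
      ¬ ∃ Q : (W.baseChange (Literature.NumberTheory.EllipticCurves.ringClassField K ι 1)).toAffine.Point,
        (2 : ℤ) • Q = d₁.derivedPoint) :
    CMHeegnerTwoPrimitiveOfTrivialShaTwo := by
  intro W _ _ _ hCM hin hρ hr hT K _ _ hK hodd h3 hH Dt hDt hc β ι d₁ hy hsha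
  exact hR0₁ W hCM hin hρ hr hT K hK hodd h3 hH
    (sum_defect_le_one_of_sha_two_eq_bot_of_printedInputs hGZ hGZK hmod hMilneC W hCM hin hρ hK hodd hH Dt β ι d₁ hy hsha)
    Dt hDt hc β ι d₁ hy hsha

end Summit.BirchSwinnertonDyer.BirchSwinnertonDyer.Theorems.KolyvaginGenusTwo
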